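import Summits.CriticalPhenomena.PercolationContinuityZ3.Theorems.PercNearOneGluingNoHeavyLowerTailQ7PsiDomReduction
import Summits.CriticalPhenomena.PercolationContinuityZ3.Theorems.PercNearOneGluingNoHeavyLowerTailCovTauTransfer
import HarnessLib

/-!
# `NoHeavyLowerTail` (stmt-CriticalPhenomena-4575) — the weak-relay half (Z*) of the (GΨ₃) certificate is DUAL to
# the observer halves (P1*), (P2*); (GΨ₃) from the two observer halves alone

Support file (`--supports stmt-CriticalPhenomena-4575`), coupling seat `prim-cplus-coupling` (gen 9).  No
definitions, no named facts, no sorries.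

Context (seat memos A5-COUPLING-gen5.md §4, A5-COUPLING-gen7.md §0; tree `Q7Psi.opart_of_halves`,
`Q7Psi.gpsi_three_of_dom`, `Q7Psi.p1star_of_cov`).  The dual certificate `Λ = Ψ − λ Dx − μ Dy ≥ 0` for the
conjecture (GΨ₃) (three relays, every monotone cluster property `F`; ⟹ Kozma–Nitzan's Question 7 for `|A| = 3`)
is the difference of an observer part (O*) = (P1*) + (P2*) and a weak-relay part (Z*).  The observer halves are
reduced in the tree to the covariance comparison (P1**) = COV(τ) (`Q7Psi.p1star_of_cov`), for which prim-hp-8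
has a refereed paper proof and a Lean chain in flight (`CovTau.covTau_of_diagonal`).  THIS FILE removes the
weak-relay part from the list of hypotheses: (Z*) FOLLOWS from (P1*) and (P2*) (stated for every monotone
cluster property), by conditioning on the owner's cluster.

* `Q7Psi.zhalf_of_xhalf` — **duality**.  If for EVERY monotone `G`
  `λ ∫_{x↮z} G(C x) ≤ ∫_{x↔o, x↮y, x↮z} G(C x) + t ∫_{x↔o, x↔y, x↮z} G(C x)` (the `x`-half (P1*)), then for
  every monotone `F`
  `∫_{x↔o, x↮y, x↮z} F(C z) + t ∫_{x↔o, x↔y, x↮z} F(C z) ≤ λ ∫_{x↮z} F(C z)`.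
  Proof: on `{x ↮ z}`, given `C_x = K` the cluster of `z` is the cluster of `z` for fresh percolation on `G`
  minus the pairs meeting `{x} ∪ V(K)` (vdBHK Lemma 2.4, tree `CovTau.tower_clusterFun`), whose mean
  `g(K) = E[F(C_z) | C_x = K]` is DECREASING in `K` (`CovTau.antitone_condMean`); the three events are
  `σ(C_x)`-events inside `{x ↮ z}`, so each `∫ F(C z)` equals `∫ g(C_x)`, and (P1*) applied to the monotone
  cluster property `−g` is the claim.
* `Q7Psi.zpart_of_halves` — (Z*) `∫_{J'} F(C z) ≤ λ ∫_{x↮z} F(C z) + μ ∫_{y↮z} F(C z)` from the two halves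
  (`J' = (o↔x ∪ o↔y) ∩ {o↮z}` is the disjoint union of the three observer worlds, as in `opart_of_halves`).
* `Q7Psi.gpsi_three_of_halves` — **(GΨ₃) from (P1*) and (P2*) alone** (any split `t`, multipliers `λ, μ ≥ 0`):
  `opart_of_halves` + `zpart_of_halves` + `gpsi_three_of_dom`.
(The one-strong-relay case (GΨ₂) is `Q7Psi.gpsi_two` in `…Q7PsiMonotone`.)
[cite: VandenbergHaggstromKahn2005, §2.1 Lemma 2.4 (p. 10), Thm 1.3 (p. 6)]
[cite: KozmaNitzan2024, §5.1 (pp. 31–32), Question 7 (p. 36), Lemma 3 (pp. 6–7)]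
-/

namespace Summit.CriticalPhenomena.PercolationContinuityZ3.Theorems

open MeasureTheory Set Literature.Probability.LatticeModels Literature.Probability.Percolation
open scoped Classical
open KNPreFKG BHK2006

noncomputable section

namespace Q7Psi

variable {V : Type*} [Fintype V]

omit [Fintype V] in
/-- The pairs meeting `{x} ∪ V(C_x)` are the pairs meeting the vertex cluster of `x`.
[cite: VandenbergHaggstromKahn2005, §1 p. 8 (definition of `W̄`)] -/
theorem barOf_openEdgeCluster_eq (ω : BondConfig V) (x : V) :
    barOf {x} (openEdgeCluster ω x) = {e : Sym2 V | ∃ v ∈ e, v ∈ openCluster ω x} := by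
  ext e
  rw [mem_barOf_iff]
  simp only [mem_singleton_iff, mem_setOf_eq, openCluster]
  constructor
  · rintro ⟨v, hve, hv⟩
    exact ⟨v, hve, (reachable_iff_exists_mem_openEdgeCluster ω x v).2 hv⟩
  · rintro ⟨v, hve, hv⟩
    exact ⟨v, hve, (reachable_iff_exists_mem_openEdgeCluster ω x v).1 hv⟩

/-- **Tower property on a `σ(C_x)`-event inside `{x ↮ z}`, vertex form**: for any `F` on vertex sets and any
family `𝒮` of edge sets, `∫_{x↮z, C_x ∈ 𝒮} F(C z) = ∫_{x↮z, C_x ∈ 𝒮} k(C(x))` with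
`k(S) = ∫ F(C_z(η ∖ {pairs meeting S})) dμ(η)`. [cite: VandenbergHaggstromKahn2005, §2.1 Lemma 2.4 (p. 10)] -/
theorem tower_weak (w : Sym2 V → unitInterval) (x z : V) (F : Set V → ℝ) (𝒮 : Set (Set (Sym2 V))) :
    ∫ ω in {ω : BondConfig V | ¬ (openGraph ω).Reachable x z} ∩ {ω | openEdgeCluster ω x ∈ 𝒮},
        F (openCluster ω z) ∂(prodBernoulli w) =
      ∫ ω in {ω : BondConfig V | ¬ (openGraph ω).Reachable x z} ∩ {ω | openEdgeCluster ω x ∈ 𝒮},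
        (∫ η, F (openCluster (η \ {e : Sym2 V | ∃ v ∈ e, v ∈ openCluster ω x}) z) ∂(prodBernoulli w))
          ∂(prodBernoulli w) := by
  rw [CovTau.tower_clusterFun w z x F 𝒮]
  refine setIntegral_congr_fun MeasurableSet.of_discrete fun ω _ => ?_
  simp only [barOf_openEdgeCluster_eq]

/-- `k(S) = E F(C_z(η ∖ {pairs meeting S}))` is DECREASING in the vertex set `S` for `F` monotone: deleting more
pairs can only shrink the cluster of `z`. [cite: VandenbergHaggstromKahn2005, §2.2 p. 12] -/
theorem condMean_antitone (w : Sym2 V → unitInterval) (z : V) (F : Set V → ℝ)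
    (hF : ∀ S T : Set V, S ⊆ T → F S ≤ F T) (S T : Set V) (hST : S ⊆ T) :
    ∫ η, F (openCluster (η \ {e : Sym2 V | ∃ v ∈ e, v ∈ T}) z) ∂(prodBernoulli w) ≤
      ∫ η, F (openCluster (η \ {e : Sym2 V | ∃ v ∈ e, v ∈ S}) z) ∂(prodBernoulli w) := by
  refine integral_mono (Integrable.of_finite) (Integrable.of_finite) fun η => ?_
  have hsub : η \ {e : Sym2 V | ∃ v ∈ e, v ∈ T} ⊆ η \ {e : Sym2 V | ∃ v ∈ e, v ∈ S} :=
    fun e he => ⟨he.1, fun ⟨v, hve, hvS⟩ => he.2 ⟨v, hve, hST hvS⟩⟩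
  exact hF _ _ (openCluster_mono hsub z)

/-- **Duality: the `x`-half of the weak-relay part (Z*) from the `x`-half (P1*) of the observer part.**  If for
every monotone cluster property `G`
`λ ∫_{x↮z} G(C x) ≤ ∫_{x↔o ∩ x↮y ∩ x↮z} G(C x) + t ∫_{x↔o ∩ x↔y ∩ x↮z} G(C x)`, then for every monotone `F`
`∫_{x↔o ∩ x↮y ∩ x↮z} F(C z) + t ∫_{x↔o ∩ x↔y ∩ x↮z} F(C z) ≤ λ ∫_{x↮z} F(C z)`.
(Condition on `C_x`: the conditional mean of `F(C z)` is a decreasing function of `C_x`, vdBHK Lemma 2.4.)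
[cite: VandenbergHaggstromKahn2005, §2.1 Lemma 2.4 (p. 10)] [cite: KozmaNitzan2024, §5.1 (pp. 31–32)] -/
theorem zhalf_of_xhalf (w : Sym2 V → unitInterval) (o x y z : V) (F : Set V → ℝ)
    (hF : ∀ S T : Set V, S ⊆ T → F S ≤ F T) (t lam : ℝ)
    (hP1 : ∀ G : Set V → ℝ, (∀ S T : Set V, S ⊆ T → G S ≤ G T) →
      lam * ∫ ω in {ω : BondConfig V | ¬ (openGraph ω).Reachable x z}, G (openCluster ω x) ∂(prodBernoulli w) ≤
        (∫ ω in openConn x o ∩ {ω | ¬ (openGraph ω).Reachable x y} ∩ {ω | ¬ (openGraph ω).Reachable x z},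
            G (openCluster ω x) ∂(prodBernoulli w)) +
          t * ∫ ω in openConn x o ∩ openConn x y ∩ {ω | ¬ (openGraph ω).Reachable x z},
            G (openCluster ω x) ∂(prodBernoulli w)) :
    (∫ ω in openConn x o ∩ {ω | ¬ (openGraph ω).Reachable x y} ∩ {ω | ¬ (openGraph ω).Reachable x z},
        F (openCluster ω z) ∂(prodBernoulli w)) +
      t * ∫ ω in openConn x o ∩ openConn x y ∩ {ω | ¬ (openGraph ω).Reachable x z},
        F (openCluster ω z) ∂(prodBernoulli w) ≤
      lam * ∫ ω in {ω : BondConfig V | ¬ (openGraph ω).Reachable x z}, F (openCluster ω z) ∂(prodBernoulli w) := by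
  classical
  set μ := prodBernoulli w with hμ
  set D : Set (BondConfig V) := {ω | ¬ (openGraph ω).Reachable x z} with hD
  -- the conditional mean of `F(C z)` given `C(x) = S`, with a sign
  set G : Set V → ℝ := fun S => - ∫ η, F (openCluster (η \ {e : Sym2 V | ∃ v ∈ e, v ∈ S}) z) ∂μ with hG
  have hGmono : ∀ S T : Set V, S ⊆ T → G S ≤ G T := fun S T hST =>
    neg_le_neg (condMean_antitone w z F hF S T hST)
  have key := hP1 G hGmono
  -- the three events as `σ(C_x)`-events inside `D`
  set 𝒮₁ : Set (Set (Sym2 V)) := {K | (o = x ∨ ∃ e ∈ K, o ∈ e) ∧ ¬ (y = x ∨ ∃ e ∈ K, y ∈ e)} with h𝒮₁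
  set 𝒮₂ : Set (Set (Sym2 V)) := {K | (o = x ∨ ∃ e ∈ K, o ∈ e) ∧ (y = x ∨ ∃ e ∈ K, y ∈ e)} with h𝒮₂
  have hE0 : D = D ∩ {ω | openEdgeCluster ω x ∈ (univ : Set (Set (Sym2 V)))} := by
    simp
  have hE1 : openConn x o ∩ {ω | ¬ (openGraph ω).Reachable x y} ∩ D = D ∩ {ω | openEdgeCluster ω x ∈ 𝒮₁} := by
    ext ω
    simp only [mem_inter_iff, openConn, mem_setOf_eq, h𝒮₁, reachable_iff_exists_mem_openEdgeCluster ω x o,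
      reachable_iff_exists_mem_openEdgeCluster ω x y]
    tauto
  have hE2 : openConn x o ∩ openConn x y ∩ D = D ∩ {ω | openEdgeCluster ω x ∈ 𝒮₂} := by
    ext ω
    simp only [mem_inter_iff, openConn, mem_setOf_eq, h𝒮₂, reachable_iff_exists_mem_openEdgeCluster ω x o,
      reachable_iff_exists_mem_openEdgeCluster ω x y]
    tauto
  -- `∫_E F(C z) = - ∫_E G(C x)` on each of them
  have hTow : ∀ 𝒮 : Set (Set (Sym2 V)),
      ∫ ω in D ∩ {ω | openEdgeCluster ω x ∈ 𝒮}, F (openCluster ω z) ∂μ =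
        - ∫ ω in D ∩ {ω | openEdgeCluster ω x ∈ 𝒮}, G (openCluster ω x) ∂μ := by
    intro 𝒮
    rw [hμ, hD, tower_weak w x z F 𝒮, ← integral_neg]
    refine setIntegral_congr_fun MeasurableSet.of_discrete fun ω _ => ?_
    simp only [hG, neg_neg, hμ]
  have i0 : ∫ ω in D, F (openCluster ω z) ∂μ = - ∫ ω in D, G (openCluster ω x) ∂μ := by
    have h := hTow univ
    rwa [← hE0] at h
  have i1 : ∫ ω in openConn x o ∩ {ω | ¬ (openGraph ω).Reachable x y} ∩ D, F (openCluster ω z) ∂μ =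
      - ∫ ω in openConn x o ∩ {ω | ¬ (openGraph ω).Reachable x y} ∩ D, G (openCluster ω x) ∂μ := by
    rw [hE1]; exact hTow 𝒮₁
  have i2 : ∫ ω in openConn x o ∩ openConn x y ∩ D, F (openCluster ω z) ∂μ =
      - ∫ ω in openConn x o ∩ openConn x y ∩ D, G (openCluster ω x) ∂μ := by
    rw [hE2]; exact hTow 𝒮₂
  rw [i0, i1, i2]
  linarith [key]

/-- **The weak-relay part (Z*) from the two observer halves.**  With `J' = (o↔x ∪ o↔y) ∩ {o↮z}`: if (P1*)
holds for every monotone cluster property (split `t`, multiplier `λ`) and (P2*) holds for every monotone cluster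
property (split `1 − t`, multiplier `μ`), then `∫_{J'} F(C z) ≤ λ ∫_{x↮z} F(C z) + μ ∫_{y↮z} F(C z)` for every
monotone `F` — the hypothesis `hZ` of `gpsi_three_of_dom`.
[cite: KozmaNitzan2024, §5.1 (pp. 31–32)] [cite: VandenbergHaggstromKahn2005, §2.1 Lemma 2.4 (p. 10)] -/
theorem zpart_of_halves (w : Sym2 V → unitInterval) (o x y z : V) (F : Set V → ℝ)
    (hF : ∀ S T : Set V, S ⊆ T → F S ≤ F T) (t lam mu : ℝ)
    (hP1 : ∀ G : Set V → ℝ, (∀ S T : Set V, S ⊆ T → G S ≤ G T) →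
      lam * ∫ ω in {ω : BondConfig V | ¬ (openGraph ω).Reachable x z}, G (openCluster ω x) ∂(prodBernoulli w) ≤
        (∫ ω in openConn x o ∩ {ω | ¬ (openGraph ω).Reachable x y} ∩ {ω | ¬ (openGraph ω).Reachable x z},
            G (openCluster ω x) ∂(prodBernoulli w)) +
          t * ∫ ω in openConn x o ∩ openConn x y ∩ {ω | ¬ (openGraph ω).Reachable x z},
            G (openCluster ω x) ∂(prodBernoulli w))
    (hP2 : ∀ G : Set V → ℝ, (∀ S T : Set V, S ⊆ T → G S ≤ G T) →
      mu * ∫ ω in {ω : BondConfig V | ¬ (openGraph ω).Reachable y z}, G (openCluster ω y) ∂(prodBernoulli w) ≤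
        (∫ ω in openConn y o ∩ {ω | ¬ (openGraph ω).Reachable y x} ∩ {ω | ¬ (openGraph ω).Reachable y z},
            G (openCluster ω y) ∂(prodBernoulli w)) +
          (1 - t) * ∫ ω in openConn y o ∩ openConn y x ∩ {ω | ¬ (openGraph ω).Reachable y z},
            G (openCluster ω y) ∂(prodBernoulli w)) :
    ∫ ω in (openConn o x ∪ openConn o y) ∩ {ω | ¬ (openGraph ω).Reachable o z},
        F (openCluster ω z) ∂(prodBernoulli w) ≤
      lam * (∫ ω in {ω : BondConfig V | ¬ (openGraph ω).Reachable x z}, F (openCluster ω z) ∂(prodBernoulli w)) +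
        mu * (∫ ω in {ω : BondConfig V | ¬ (openGraph ω).Reachable y z}, F (openCluster ω z) ∂(prodBernoulli w)) := by
  classical
  set μ' := prodBernoulli w with hμ
  set S1 : Set (BondConfig V) :=
    openConn x o ∩ {ω | ¬ (openGraph ω).Reachable x y} ∩ {ω | ¬ (openGraph ω).Reachable x z} with hS1
  set S2 : Set (BondConfig V) :=
    openConn y o ∩ {ω | ¬ (openGraph ω).Reachable y x} ∩ {ω | ¬ (openGraph ω).Reachable y z} with hS2
  set S3 : Set (BondConfig V) := openConn x o ∩ openConn x y ∩ {ω | ¬ (openGraph ω).Reachable x z} with hS3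
  set S3' : Set (BondConfig V) := openConn y o ∩ openConn y x ∩ {ω | ¬ (openGraph ω).Reachable y z} with hS3'
  set J' : Set (BondConfig V) := (openConn o x ∪ openConn o y) ∩ {ω | ¬ (openGraph ω).Reachable o z} with hJ'
  have hmeas : ∀ S : Set (BondConfig V), MeasurableSet S := fun _ => MeasurableSet.of_discrete
  have hint : ∀ (g : BondConfig V → ℝ) (S : Set (BondConfig V)), IntegrableOn g S μ' :=
    fun g S => (Integrable.of_finite).integrableOn
  have hx := zhalf_of_xhalf w o x y z F hF t lam hP1
  have hy := zhalf_of_xhalf w o y x z F hF (1 - t) mu hP2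
  change (∫ ω in S1, F (openCluster ω z) ∂μ') + t * ∫ ω in S3, F (openCluster ω z) ∂μ' ≤
    lam * ∫ ω in {ω : BondConfig V | ¬ (openGraph ω).Reachable x z}, F (openCluster ω z) ∂μ' at hx
  change (∫ ω in S2, F (openCluster ω z) ∂μ') + (1 - t) * ∫ ω in S3', F (openCluster ω z) ∂μ' ≤
    mu * ∫ ω in {ω : BondConfig V | ¬ (openGraph ω).Reachable y z}, F (openCluster ω z) ∂μ' at hy
  -- `S3 = S3'`
  have h33 : S3 = S3' := by
    ext ω
    simp only [hS3, hS3', mem_inter_iff, mem_setOf_eq, openConn]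
    constructor
    · rintro ⟨⟨hxo, hxy⟩, hxz⟩
      exact ⟨⟨hxy.symm.trans hxo, hxy.symm⟩, fun hyz => hxz (hxy.trans hyz)⟩
    · rintro ⟨⟨hyo, hyx⟩, hyz⟩
      exact ⟨⟨hyx.symm.trans hyo, hyx.symm⟩, fun hxz => hyz (hyx.trans hxz)⟩
  -- `J' = S1 ∪ S2 ∪ S3`, pairwise disjoint
  have hJeq : J' = (S1 ∪ S2) ∪ S3 := by
    ext ω
    simp only [hJ', hS1, hS2, hS3, mem_inter_iff, mem_union, mem_setOf_eq, openConn]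
    constructor
    · rintro ⟨hJ, hoz⟩
      by_cases hox : (openGraph ω).Reachable o x
      · by_cases hxy : (openGraph ω).Reachable x y
        · exact Or.inr ⟨⟨hox.symm, hxy⟩, fun hxz => hoz (hox.trans hxz)⟩
        · exact Or.inl (Or.inl ⟨⟨hox.symm, hxy⟩, fun hxz => hoz (hox.trans hxz)⟩)
      · have hoy : (openGraph ω).Reachable o y := by
          rcases hJ with h | h
          · exact absurd h hox
          · exact h
        refine Or.inl (Or.inr ⟨⟨hoy.symm, fun hyx => hox (hoy.trans hyx)⟩, fun hyz => hoz (hoy.trans hyz)⟩)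
    · rintro ((⟨⟨hxo, _⟩, hxz⟩ | ⟨⟨hyo, _⟩, hyz⟩) | ⟨⟨hxo, _⟩, hxz⟩)
      · exact ⟨Or.inl hxo.symm, fun hoz => hxz (hxo.trans hoz)⟩
      · exact ⟨Or.inr hyo.symm, fun hoz => hyz (hyo.trans hoz)⟩
      · exact ⟨Or.inl hxo.symm, fun hoz => hxz (hxo.trans hoz)⟩
  have hd12 : Disjoint S1 S2 := by
    rw [Set.disjoint_left]
    rintro ω ⟨⟨hxo, hxy⟩, _⟩ ⟨⟨hyo, _⟩, _⟩
    exact hxy (SimpleGraph.Reachable.trans hxo (SimpleGraph.Reachable.symm hyo))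
  have hd123 : Disjoint (S1 ∪ S2) S3 := by
    rw [Set.disjoint_left]
    rintro ω (⟨⟨_, hxy⟩, _⟩ | ⟨⟨_, hyx⟩, _⟩) ⟨⟨_, hxy'⟩, _⟩
    · exact hxy hxy'
    · exact hyx (SimpleGraph.Reachable.symm hxy')
  have hsplit : ∫ ω in J', F (openCluster ω z) ∂μ' =
      ∫ ω in S1, F (openCluster ω z) ∂μ' + ∫ ω in S2, F (openCluster ω z) ∂μ' +
        ∫ ω in S3, F (openCluster ω z) ∂μ' := by
    rw [hJeq, setIntegral_union hd123 (hmeas _) (hint _ _) (hint _ _),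
      setIntegral_union hd12 (hmeas _) (hint _ _) (hint _ _)]
  have e3 : ∫ ω in S3, F (openCluster ω z) ∂μ' =
      t * ∫ ω in S3, F (openCluster ω z) ∂μ' + (1 - t) * ∫ ω in S3', F (openCluster ω z) ∂μ' := by
    rw [← h33]; ring
  rw [hsplit, e3]
  linarith

/-- **(GΨ₃) from the two observer halves alone.**  If the `x`-half (P1*) and the `y`-half (P2*) of the dual
certificate hold for EVERY monotone cluster property (some split `t`, multipliers `λ, μ ≥ 0`), then for every
monotone `F` with `E F(C z) ≤ E F(C x)` and `E F(C z) ≤ E F(C y)`: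
`∫_{o↔x ∪ o↔y} F(C z) ≤ ∫_{o↔x ∪ o↔y} F(C o)`.
(Observer part by `opart_of_halves`, weak-relay part by `zpart_of_halves`, then `gpsi_three_of_dom`.)
[cite: KozmaNitzan2024, §5.1 (pp. 31–32), Question 7 (p. 36)] -/
theorem gpsi_three_of_halves (w : Sym2 V → unitInterval) (o x y z : V) (F : Set V → ℝ)
    (hF : ∀ S T : Set V, S ⊆ T → F S ≤ F T) (t lam mu : ℝ) (hlam : 0 ≤ lam) (hmu : 0 ≤ mu)
    (hP1 : ∀ G : Set V → ℝ, (∀ S T : Set V, S ⊆ T → G S ≤ G T) →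
      lam * ∫ ω in {ω : BondConfig V | ¬ (openGraph ω).Reachable x z}, G (openCluster ω x) ∂(prodBernoulli w) ≤
        (∫ ω in openConn x o ∩ {ω | ¬ (openGraph ω).Reachable x y} ∩ {ω | ¬ (openGraph ω).Reachable x z},
            G (openCluster ω x) ∂(prodBernoulli w)) +
          t * ∫ ω in openConn x o ∩ openConn x y ∩ {ω | ¬ (openGraph ω).Reachable x z},
            G (openCluster ω x) ∂(prodBernoulli w))
    (hP2 : ∀ G : Set V → ℝ, (∀ S T : Set V, S ⊆ T → G S ≤ G T) →
      mu * ∫ ω in {ω : BondConfig V | ¬ (openGraph ω).Reachable y z}, G (openCluster ω y) ∂(prodBernoulli w) ≤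
        (∫ ω in openConn y o ∩ {ω | ¬ (openGraph ω).Reachable y x} ∩ {ω | ¬ (openGraph ω).Reachable y z},
            G (openCluster ω y) ∂(prodBernoulli w)) +
          (1 - t) * ∫ ω in openConn y o ∩ openConn y x ∩ {ω | ¬ (openGraph ω).Reachable y z},
            G (openCluster ω y) ∂(prodBernoulli w))
    (hx : ∫ ω, F (openCluster ω z) ∂(prodBernoulli w) ≤ ∫ ω, F (openCluster ω x) ∂(prodBernoulli w))
    (hy : ∫ ω, F (openCluster ω z) ∂(prodBernoulli w) ≤ ∫ ω, F (openCluster ω y) ∂(prodBernoulli w)) :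
    ∫ ω in (openConn o x ∪ openConn o y), F (openCluster ω z) ∂(prodBernoulli w) ≤
      ∫ ω in (openConn o x ∪ openConn o y), F (openCluster ω o) ∂(prodBernoulli w) :=
  gpsi_three_of_dom w o x y z F lam mu hlam hmu (opart_of_halves w o x y z F t lam mu (hP1 F hF) (hP2 F hF))
    (zpart_of_halves w o x y z F hF t lam mu hP1 hP2) hx hy

end Q7Psi

end

end Summit.CriticalPhenomena.PercolationContinuityZ3.Theorems
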